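import Literature.NumberTheory.LFunctions.XiHigherDerivativesCriticalStrip
import Literature.Analysis.Complex.JensenCircles
import HarnessLib

/-!
# Jensen nesting for `Ξ`: every non-real zero of `Ξ′` lies in a closed Jensen disc of a non-real zero of `Ξ`

RH-FREE, unconditional.  Route `LaguerreSpeiserSplit`; registered stub `stub_jensenNesting` of the
line «Levinson–Conrey ladder» (L42) on crux `XiPrimeOnLine` (stmt-RiemannHypothesis-18896), shared
verbatim with the far-rung skeleton of `XiPrimeRealBelowVerifiedHeight` (stmt-RiemannHypothesis-23771).
Nothing here bears on the truth of RH; RH is NOT proved by this file.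

**Statement.**  If `Ξ′(z) = 0` and `Im z ≠ 0`, then there is a zero `ρ` of `Ξ` with `Im ρ ≠ 0` and
`‖z − Re ρ‖ ≤ |Im ρ|`, i.e. `z` lies in the closed disc with diameter `[ρ̄, ρ]` (Jensen 1913; Ki–Kim,
*Duke Math. J.* **104** (2000) §2 p. 50).

**Proof.**  Direct instantiation of the tree's Hadamard-free Jensen circle theorem for real entire
functions of order `< 2` (`Literature.Analysis.Complex.jensen_circle`) with the genus-one inputs for
`Ξ`: entire (`XiDerivStrip.differentiable_xiUpper`), `‖Ξ(z)‖ ≤ C e^{‖z‖^{15/8}}`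
(`exists_growth_riemannXiUpper`), real on `ℝ` (`im_riemannXiUpper_ofReal_holds`), `Ξ′ ≢ 0`
(`iteratedDeriv_riemannXiUpper_ne_zero 1`).  The zero `ρ` produced is non-real because `Im ρ = 0`
would force `‖z − Re ρ‖ ≤ 0`, i.e. `z = Re ρ` real.
-/

-- `Summit.RiemannHypothesis.RiemannHypothesis.…` repeats a component by the tree's layout (D-0017).
set_option linter.dupNamespace false

noncomputable section

namespace Summit.RiemannHypothesis.RiemannHypothesis.Theorems.XiPrimeOnLine

open Literature.NumberTheory.LFunctions

/-- **Jensen nesting for `Ξ` (registered stub `stub_jensenNesting`, RH-free).**  Every non-real zero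
`z` of `Ξ′` lies in the closed Jensen disc `‖z − Re ρ‖ ≤ |Im ρ|` of some non-real zero `ρ` of `Ξ`
(Jensen's circle theorem for the real entire function `Ξ` of order `< 2`; engine
`Literature.Analysis.Complex.jensen_circle`, Ki–Kim 2000 §2).  Nothing here bears on the truth of RH. -/
theorem stub_jensenNesting :
    ∀ z : ℂ, deriv riemannXiUpper z = 0 → z.im ≠ 0 →
      ∃ ρ : ℂ, riemannXiUpper ρ = 0 ∧ ρ.im ≠ 0 ∧ ‖z - (ρ.re : ℂ)‖ ≤ |ρ.im| := by
  intro z hz hzim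
  obtain ⟨ρ₀, C, hρ0, hρ2, hgr⟩ := exists_growth_riemannXiUpper
  have hf' : ∃ w, deriv riemannXiUpper w ≠ 0 := by
    have h := iteratedDeriv_riemannXiUpper_ne_zero 1
    rw [iteratedDeriv_one] at h
    exact Function.ne_iff.1 h
  obtain ⟨a, ha, hdisc⟩ := Literature.Analysis.Complex.jensen_circle
    XiDerivStrip.differentiable_xiUpper hρ0 hρ2 hgr im_riemannXiUpper_ofReal_holds hf' hzim hz
  refine ⟨a, ha, fun haim ↦ hzim ?_, hdisc⟩
  rw [haim, abs_zero] at hdisc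
  have hza : z - (a.re : ℂ) = 0 := norm_le_zero_iff.1 hdisc
  simpa using congrArg Complex.im hza

end Summit.RiemannHypothesis.RiemannHypothesis.Theorems.XiPrimeOnLine

end
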